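import Summits.ValiantsHypothesis.ValiantsHypothesis.Theorems.BarrierLeverPartitionMinorsHitByVPHiddenStatesBallCutFree
import Summits.ValiantsHypothesis.ValiantsHypothesis.Theorems.BarrierLeverChowBenchmarkPairsBlockPeelCertPack

/-!
# Route BarrierLever — item `PartitionMinorsHitByVP` (stmt-ValiantsHypothesis-19717), line `hidden-states`:
# THE BALL-CUT CERTIFICATE KIT — a swap-family class is served as soon as ONE packed LU check modulo a prime passes

Helper file (`--supports stmt-ValiantsHypothesis-19717`; cell valiant-natproofs, 𝒟-side door (c), registered line
`Cruxes/PartitionMinorsHitByVP/Lines/hidden_states.lean` v10; prover seat val-np-p6 gen 22; planner SUGGESTION of record STATUS l.1903: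
«certify the 38 support-9…15 cores with the PACKED-LU certificate kit of the 22038 lane»).  Closes NO item; nothing is certified HERE.

THE POINT.  The m-th-shell column (memo HOME/val-np-p6/g21/MEMO-valnp6-g21.md) reduces `S_m` (every m-swap family
`𝒰 = B_t ∖ {A_l} ∪ {C_l}` of the ball `B_t` is served by some table) to finitely many TOTALLY UNBALANCED CORES per `t`
(`…BallCutReductionM`), each a statement at its support `Fin n` that the free-coordinate theorem
(`exists_table_multiSwap_map_embedding`, `…BallCutFree`) carries to every `h`.  val-np-p6 g21 certified the cores of support `≤ 8` by
explicit adjugates (`M * adj = d • 1`, `decide +kernel`), which stops at `93 × 93`.  This file makes EVERY core (any `n, t, m`) a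
twenty-line file with NO matrix data, by reusing the packed LU kit of val-np-p4 g30 (`…ChowBenchmarkPairsBlockPeelCertPack`:
`packedLUP` unverified, `packCheckP` / `lupPermCheck` verified, `det_ne_zero_of_packCheckP`):
* `codeSet` / `allSets` — the canonical enumeration of `Finset (Fin n)` by binary codes (`mem_allSets`, `nodup_allSets`, via
  `finFunctionFinEquiv`); `ballList n t` (the ball `B_t(n)`) and `swapList n t A C` (the swap family) in code order;
* `stdTable s n` — a fixed formulaic integer table `T_{q,a} = ((17q + 31a + s)² + 3qa + 1) mod 61` (no per-core search: `s = 7` serves all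
  61 + 11 charted cores of support `≥ 7` modulo `65521`, lab/certcheck.py);
* `canonMat R rows cols T r` — the canonical matrix `∏_{a ∈ U_i} ∑_{q ∈ J_k} T_{q,a}` over any commutative semiring; `certTable` — its
  flat table over `ZMod p` (rows `swapList`, columns `ballList`), the input of `packedLUP`;
* ★ `exists_table_of_packCert` — **if `packCheckP (certTable n t A C T p) lu perm |B_t(n)| p` and `lupPermCheck perm pinv |B_t(n)|`
  hold (one `native_decide` in the core file, computational lane) then the family `B_t(n) ∖ {A_l} ∪ {C_l}` is served in the column's
  standard form** (kernel: `rigidity` ⇒ the rows/columns are permutations of the canonical lists; the standard-form matrix at the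
  table `tx (some q) a = T q a`, base `0`, is `± det` of the canonical INTEGER matrix, whose reduction mod `p` is nonsingular by the
  certificate); ★ `exists_table_of_packCert_map` — the same for every `h` along any `σ : Fin n ↪ Fin h`.

HONEST LABEL: toolkit for the conjecture column (third shell and beyond); 19717 stays OPEN; nothing on crux 14610 or VP ≠ VNP.
-/

set_option linter.dupNamespace false

namespace Summit.ValiantsHypothesis.ValiantsHypothesis.Theorems.BarrierLever.HiddenStates

open Finset

namespace BallCut

open SymbJoin MoorePeel

/-! ## 1. The canonical enumeration of `Finset (Fin n)` by binary codes -/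

/-- The subset of `Fin n` coded by `c`: `a ∈ codeSet n c ↔` binary digit `a` of `c` is `1`. -/
def codeSet (n c : ℕ) : Finset (Fin n) := Finset.univ.filter fun a => c / 2 ^ a.val % 2 = 1

/-- All subsets of `Fin n`, in code order. -/
def allSets (n : ℕ) : List (Finset (Fin n)) := (List.range (2 ^ n)).map (codeSet n)

/-- The coded set of `c < 2^n` is read off the digit function `finFunctionFinEquiv.symm c : Fin n → Fin 2`. -/
theorem mem_codeSet_iff {n c : ℕ} (hc : c < 2 ^ n) (a : Fin n) :
    a ∈ codeSet n c ↔ (finFunctionFinEquiv.symm (⟨c, hc⟩ : Fin (2 ^ n)) a : ℕ) = 1 := by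
  rw [codeSet, Finset.mem_filter, finFunctionFinEquiv_symm_apply_val]
  simp

/-- Every subset of `Fin n` is listed. -/
theorem mem_allSets {n : ℕ} (U : Finset (Fin n)) : U ∈ allSets n := by
  classical
  rw [allSets, List.mem_map]
  set f : Fin n → Fin 2 := fun a => if a ∈ U then 1 else 0 with hf
  refine ⟨(finFunctionFinEquiv f : ℕ), List.mem_range.mpr (finFunctionFinEquiv f).2, ?_⟩
  ext a
  rw [mem_codeSet_iff (finFunctionFinEquiv f).2, Fin.eta, Equiv.symm_apply_apply, hf]
  by_cases ha : a ∈ U <;> simp [ha]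

/-- The list has no duplicates. -/
theorem nodup_allSets (n : ℕ) : (allSets n).Nodup := by
  rw [allSets]
  refine List.Nodup.map_on (fun c hc c' hc' hcc' => ?_) (List.nodup_range)
  rw [List.mem_range] at hc hc'
  have hfun : finFunctionFinEquiv.symm (⟨c, hc⟩ : Fin (2 ^ n)) = finFunctionFinEquiv.symm (⟨c', hc'⟩ : Fin (2 ^ n)) := by
    funext a
    have h1 := mem_codeSet_iff hc a
    have h2 := mem_codeSet_iff hc' a
    rw [hcc'] at h1
    have := h1.symm.trans h2
    apply Fin.ext
    have l1 := (finFunctionFinEquiv.symm (⟨c, hc⟩ : Fin (2 ^ n)) a).2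
    have l2 := (finFunctionFinEquiv.symm (⟨c', hc'⟩ : Fin (2 ^ n)) a).2
    omega
  have := congrArg (fun g => (finFunctionFinEquiv g : ℕ)) hfun
  simpa using this

/-- The ball `B_t(n)` (all `J ⊆ Fin n` with `|J| ≤ t`), in code order. -/
def ballList (n t : ℕ) : List (Finset (Fin n)) := (allSets n).filter fun J => decide (J.card ≤ t)

/-- The swap family `B_t(n) ∖ {A_l} ∪ {C_l}`, in code order. -/
def swapList (n t : ℕ) {m : ℕ} (A C : Fin m → Finset (Fin n)) : List (Finset (Fin n)) :=
  (allSets n).filter fun U => decide ((U.card ≤ t ∧ ∀ l, U ≠ A l) ∨ ∃ l, U = C l)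

/-- Membership in the ball list. -/
theorem mem_ballList {n t : ℕ} (J : Finset (Fin n)) : J ∈ ballList n t ↔ J.card ≤ t := by
  rw [ballList, List.mem_filter, decide_eq_true_eq]
  exact ⟨fun h => h.2, fun h => ⟨mem_allSets J, h⟩⟩

/-- Membership in the swap list. -/
theorem mem_swapList {n t m : ℕ} (A C : Fin m → Finset (Fin n)) (U : Finset (Fin n)) :
    U ∈ swapList n t A C ↔ ((U.card ≤ t ∧ ∀ l, U ≠ A l) ∨ ∃ l, U = C l) := by
  rw [swapList, List.mem_filter, decide_eq_true_eq]
  exact ⟨fun h => h.2, fun h => ⟨mem_allSets U, h⟩⟩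

/-- The ball list has no duplicates. -/
theorem nodup_ballList (n t : ℕ) : (ballList n t).Nodup := (nodup_allSets n).filter _

/-- The swap list has no duplicates. -/
theorem nodup_swapList (n t : ℕ) {m : ℕ} (A C : Fin m → Finset (Fin n)) : (swapList n t A C).Nodup :=
  (nodup_allSets n).filter _

/-- `|B_t(n)| ≤ 2^n` (as a list length). -/
theorem length_ballList_le (n t : ℕ) : (ballList n t).length ≤ 2 ^ n := by
  rw [ballList]
  refine (List.length_filter_le _ _).trans ?_
  rw [allSets, List.length_map, List.length_range]

/-! ## 2. The table, the canonical matrix and its flat mod-`p` table -/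

/-- **The standard formulaic table** `T_{q,a} = ((17 q + 31 a + s)² + 3 q a + 1) mod 61` (state `q` read by coordinate `a`). -/
def stdTable (s n : ℕ) (q a : Fin n) : ℕ := ((17 * q.val + 31 * a.val + s) ^ 2 + 3 * q.val * a.val + 1) % 61

/-- **The canonical matrix** of a row list / column list at an integer table `T`, base point `0`, over any commutative semiring:
entry `(i, k) = ∏_{a ∈ U_i} ∑_{q ∈ J_k} T_{q,a}`. -/
def canonMat (R : Type*) [CommSemiring R] {n : ℕ} (rows cs : Array (Finset (Fin n))) (T : Fin n → Fin n → ℕ) (r : ℕ) :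
    Matrix (Fin r) (Fin r) R :=
  Matrix.of fun i k => ∏ a ∈ rows.getD i.val ∅, ∑ q ∈ cs.getD k.val ∅, (T q a : R)

/-- **The certificate table**: the flat row-major table of the canonical matrix over `ZMod p` (rows `swapList`, columns `ballList`,
both computed ONCE under evaluation) — the input of `MoorePeel.packedLUP`. -/
def certTable (n t : ℕ) {m : ℕ} (A C : Fin m → Finset (Fin n)) (T : Fin n → Fin n → ℕ) (p : ℕ) : Array ℕ :=
  let R := (ballList n t).length
  let rows := (swapList n t A C).toArray
  let cs := (ballList n t).toArray
  flatTable R (canonMat (ZMod p) rows cs T R)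

/-- KERNEL: the certificate table IS the canonical matrix over `ZMod p`. -/
theorem flatMat_certTable (n t : ℕ) {m : ℕ} (A C : Fin m → Finset (Fin n)) (T : Fin n → Fin n → ℕ) (p : ℕ) [NeZero p] :
    flatMat p (certTable n t A C T p) (ballList n t).length
      = canonMat (ZMod p) (swapList n t A C).toArray (ballList n t).toArray T (ballList n t).length :=
  flatMat_flatTable _ _

/-- The canonical matrix over `R` is the image of the canonical INTEGER matrix. -/
theorem canonMat_map {R : Type*} [CommRing R] {n : ℕ} (rows cs : Array (Finset (Fin n))) (T : Fin n → Fin n → ℕ) (r : ℕ) :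
    (canonMat ℤ rows cs T r).map (Int.castRingHom R) = canonMat R rows cs T r := by
  ext i k
  simp [canonMat]

/-- Reading an array made from a list. -/
theorem getD_toArray_eq_get {α : Type*} (l : List α) (d : α) (i : Fin l.length) : l.toArray.getD i.val d = l.get i := by
  rw [Array.getD_eq_getD_getElem?, List.getElem?_toArray, List.getElem?_eq_getElem i.2, Option.getD_some, List.get_eq_getElem]

/-- Reindexing rows and columns by two bijections keeps a nonzero determinant nonzero. -/
theorem det_submatrix_ne_zero_of_det_ne_zero {R : Type*} [CommRing R] {ι κ : Type*} [Fintype ι] [DecidableEq ι] [Fintype κ]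
    [DecidableEq κ] (X : Matrix κ κ R) (e₁ e₂ : ι ≃ κ) (hX : X.det ≠ 0) : (X.submatrix e₁ e₂).det ≠ 0 := by
  have hsub : X.submatrix e₁ e₂ = (X.submatrix e₁ e₁).submatrix id (e₂.trans e₁.symm) := by
    ext i k
    simp
  rw [hsub, Matrix.det_permute', Matrix.det_submatrix_equiv_self]
  rcases Int.units_eq_one_or (Equiv.Perm.sign (e₂.trans e₁.symm)) with h1 | h1 <;> simp [h1, hX]

/-! ## 3. The certificate theorem -/

/-- ★ **A PASSED PACKED LU CHECK SERVES THE CLASS (standard form at the support).**  For `t`-sets `A_l` and `(t+1)`-sets `C_l`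
(both injective) on `Fin n`, an integer table `T`, a prime `p` with `2^n p² < 2^64` and ANY candidate `lu, perm, pinv`:
if `packCheckP (certTable n t A C T p) lu perm |B_t(n)| p = true` and `lupPermCheck perm pinv |B_t(n)| = true`, then every
standard-form configuration of the family `B_t(n) ∖ {A_l} ∪ {C_l}` against the ball has a table with nonzero determinant. -/
theorem exists_table_of_packCert (n t : ℕ) {m : ℕ} (A C : Fin m → Finset (Fin n))
    (hA : ∀ l, (A l).card = t) (hC : ∀ l, (C l).card = t + 1)
    (hAi : Function.Injective A) (hCi : Function.Injective C)
    (T : Fin n → Fin n → ℕ) {p : ℕ} (hp : p.Prime) (hB : 2 ^ n * (p * p) < packBase)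
    (lu perm pinv : Array ℕ)
    (hchk : packCheckP (certTable n t A C T p) lu perm (ballList n t).length p = true)
    (hperm : lupPermCheck perm pinv (ballList n t).length = true)
    {r : ℕ} (u cols : Fin r → Finset (Fin n)) (hu : Function.Injective u)
    (hU : ∀ i, ((u i).card ≤ t ∧ ∀ l, u i ≠ A l) ∨ ∃ l, u i = C l)
    (hcols : ∀ J : Finset (Fin n), J.card ≤ t → ∃ k, cols k = J) :
    ∃ tx : Option (Fin n) → Fin n → ℂ,
      (Matrix.of fun i k : Fin r => ∏ a ∈ u i, (tx none a + ∑ q ∈ cols k, tx (some q) a)).det ≠ 0 := by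
  classical
  haveI : Fact p.Prime := ⟨hp⟩
  obtain ⟨hcinj, hUr, hJr⟩ := rigidity t A C hA hC hAi hCi u cols hu hU hcols
  -- the canonical lists
  set LU := swapList n t A C with hLU
  set LB := ballList n t with hLB
  have hgu : Function.Injective LU.get := List.nodup_iff_injective_get.mp (nodup_swapList n t A C)
  have hgc : Function.Injective LB.get := List.nodup_iff_injective_get.mp (nodup_ballList n t)
  have hru : Set.range u = Set.range LU.get := by
    ext U
    rw [Set.mem_range, Set.mem_range, hUr U, ← mem_swapList A C U, List.mem_iff_get]
  have hrc : Set.range cols = Set.range LB.get := by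
    ext J
    rw [Set.mem_range, Set.mem_range, hJr J, ← mem_ballList J, List.mem_iff_get]
  -- index bijections
  set e : Fin r ≃ Fin LU.length :=
    (Equiv.ofInjective u hu).trans ((Equiv.setCongr hru).trans (Equiv.ofInjective _ hgu).symm) with he_def
  set e' : Fin r ≃ Fin LB.length :=
    (Equiv.ofInjective cols hcinj).trans ((Equiv.setCongr hrc).trans (Equiv.ofInjective _ hgc).symm) with he'_def
  have he : ∀ i, LU.get (e i) = u i := fun i => by
    rw [he_def, Equiv.trans_apply, Equiv.trans_apply, Equiv.apply_ofInjective_symm hgu]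
    rfl
  have he' : ∀ k, LB.get (e' k) = cols k := fun k => by
    rw [he'_def, Equiv.trans_apply, Equiv.trans_apply, Equiv.apply_ofInjective_symm hgc]
    rfl
  have hlen : LU.length = LB.length := by
    simpa [Fintype.card_fin] using Fintype.card_congr (e.symm.trans e')
  set e₁ : Fin r ≃ Fin LB.length := e.trans (finCongr hlen) with he₁_def
  have hrows : ∀ i : Fin r, LU.toArray.getD (e₁ i).val ∅ = u i := fun i => by
    rw [he₁_def, Equiv.trans_apply, finCongr_apply, Fin.val_cast, getD_toArray_eq_get, he]
  have hcs : ∀ k : Fin r, LB.toArray.getD (e' k).val ∅ = cols k := fun k => by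
    rw [getD_toArray_eq_get, he']
  -- the canonical integer matrix is nonsingular: its reduction mod `p` is, by the certificate
  have hRB : LB.length * (p * p) < packBase := lt_of_le_of_lt (Nat.mul_le_mul_right _ (length_ballList_le n t)) hB
  have hdetp : (canonMat (ZMod p) LU.toArray LB.toArray T LB.length).det ≠ 0 :=
    det_ne_zero_of_packCheckP LB.length _ (certTable n t A C T p) lu perm pinv (flatMat_certTable n t A C T p) hRB hchk hperm
  have hdetN : (canonMat ℤ LU.toArray LB.toArray T LB.length).det ≠ 0 := by
    intro h0
    apply hdetp
    rw [← canonMat_map, ← RingHom.mapMatrix_apply, ← RingHom.map_det, h0, map_zero]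
  have hdetC : ((canonMat ℤ LU.toArray LB.toArray T LB.length).map (Int.castRingHom ℂ)).det ≠ 0 := by
    rw [← RingHom.mapMatrix_apply, ← RingHom.map_det, eq_intCast, Int.cast_ne_zero]
    exact hdetN
  -- the table: base point `0`, state `q` read by coordinate `a` with weight `T q a`
  refine ⟨fun o a => Option.elim o 0 fun q => (T q a : ℂ), ?_⟩
  have hM : (Matrix.of fun i k : Fin r =>
      ∏ a ∈ u i, ((fun (o : Option (Fin n)) (a : Fin n) => Option.elim o (0 : ℂ) fun q => (T q a : ℂ)) none a +
        ∑ q ∈ cols k, (fun (o : Option (Fin n)) (a : Fin n) => Option.elim o (0 : ℂ) fun q => (T q a : ℂ)) (some q) a))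
      = ((canonMat ℤ LU.toArray LB.toArray T LB.length).map (Int.castRingHom ℂ)).submatrix e₁ e' := by
    ext i k
    rw [Matrix.submatrix_apply, canonMat_map, canonMat, Matrix.of_apply, Matrix.of_apply, hrows, hcs]
    simp
  rw [hM]
  exact det_submatrix_ne_zero_of_det_ne_zero _ e₁ e' hdetC

/-- ★ **THE CLASS IS SERVED FOR EVERY `h`** (the core plus any number of free coordinates, along any `σ : Fin n ↪ Fin h`), from the
same passed check. -/
theorem exists_table_of_packCert_map (n t : ℕ) {h : ℕ} (σ : Fin n ↪ Fin h) {m : ℕ} (A C : Fin m → Finset (Fin n))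
    (hA : ∀ l, (A l).card = t) (hC : ∀ l, (C l).card = t + 1)
    (hAi : Function.Injective A) (hCi : Function.Injective C)
    (T : Fin n → Fin n → ℕ) {p : ℕ} (hp : p.Prime) (hB : 2 ^ n * (p * p) < packBase)
    (lu perm pinv : Array ℕ)
    (hchk : packCheckP (certTable n t A C T p) lu perm (ballList n t).length p = true)
    (hperm : lupPermCheck perm pinv (ballList n t).length = true)
    {r : ℕ} (u cols : Fin r → Finset (Fin h)) (hu : Function.Injective u)
    (hU : ∀ i, ((u i).card ≤ t ∧ ∀ l, u i ≠ (A l).map σ) ∨ ∃ l, u i = (C l).map σ)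
    (hcols : ∀ J : Finset (Fin h), J.card ≤ t → ∃ k, cols k = J) :
    ∃ tx : Option (Fin h) → Fin h → ℂ,
      (Matrix.of fun i k : Fin r => ∏ a ∈ u i, (tx none a + ∑ q ∈ cols k, tx (some q) a)).det ≠ 0 :=
  exists_table_multiSwap_map_embedding n t σ A C hA hC hAi hCi
    (fun _ u' cols' hu' hU' hcols' =>
      exists_table_of_packCert n t A C hA hC hAi hCi T hp hB lu perm pinv hchk hperm u' cols' hu' hU' hcols')
    u cols hu hU hcols

/-- `65521` (the largest prime below `2^16`) is prime. -/
theorem prime_65521 : Nat.Prime 65521 := by norm_num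

/-! ## 4. Batch API (appended by val-np-p6 g22, same seat): ONE Boolean check for one class, or for a whole LIST of coded classes

With this, a certificate file needs no per-core `def`s: `theorem c : certCheck n t A C (stdTable s n) p = true := by native_decide`
and `exists_table_of_certCheck[_map]`; and a whole chart level is ONE `native_decide` on `certCheckList3 n t s p [codes…]` followed by
`exists_table_of_mem_certCheckList3` (every listed class served for every `h`).  A third-shell class on `Fin n` is coded by six naturals:
the binary codes (`codeSet`) of `A_0, A_1, A_2, C_0, C_1, C_2`; the shape hypotheses (cards, injectivity) are part of the check. -/

/-- **The complete check of ONE class** at the integer table `T` modulo `p`: compute the packed LU candidate in place and run both verified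
checkers (`packCheckP`, `lupPermCheck`). -/
def certCheck (n t : ℕ) {m : ℕ} (A C : Fin m → Finset (Fin n)) (T : Fin n → Fin n → ℕ) (p : ℕ) : Bool :=
  let R := (ballList n t).length
  let tab := certTable n t A C T p
  let c := packedLUP tab R p
  packCheckP tab c.1 c.2 R p && lupPermCheck c.2 (lupPermInv c.2 R) R

/-- ★ A passed `certCheck` serves the class (standard form at the support). -/
theorem exists_table_of_certCheck (n t : ℕ) {m : ℕ} (A C : Fin m → Finset (Fin n))
    (hA : ∀ l, (A l).card = t) (hC : ∀ l, (C l).card = t + 1)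
    (hAi : Function.Injective A) (hCi : Function.Injective C)
    (T : Fin n → Fin n → ℕ) {p : ℕ} (hp : p.Prime) (hB : 2 ^ n * (p * p) < packBase)
    (h : certCheck n t A C T p = true)
    {r : ℕ} (u cols : Fin r → Finset (Fin n)) (hu : Function.Injective u)
    (hU : ∀ i, ((u i).card ≤ t ∧ ∀ l, u i ≠ A l) ∨ ∃ l, u i = C l)
    (hcols : ∀ J : Finset (Fin n), J.card ≤ t → ∃ k, cols k = J) :
    ∃ tx : Option (Fin n) → Fin n → ℂ,
      (Matrix.of fun i k : Fin r => ∏ a ∈ u i, (tx none a + ∑ q ∈ cols k, tx (some q) a)).det ≠ 0 := by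
  simp only [certCheck, Bool.and_eq_true] at h
  exact exists_table_of_packCert n t A C hA hC hAi hCi T hp hB _ _ _ h.1 h.2 u cols hu hU hcols

/-- ★ A passed `certCheck` serves the class for every `h` along any `σ : Fin n ↪ Fin h`. -/
theorem exists_table_of_certCheck_map (n t : ℕ) {h : ℕ} (σ : Fin n ↪ Fin h) {m : ℕ} (A C : Fin m → Finset (Fin n))
    (hA : ∀ l, (A l).card = t) (hC : ∀ l, (C l).card = t + 1)
    (hAi : Function.Injective A) (hCi : Function.Injective C)
    (T : Fin n → Fin n → ℕ) {p : ℕ} (hp : p.Prime) (hB : 2 ^ n * (p * p) < packBase)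
    (hc : certCheck n t A C T p = true)
    {r : ℕ} (u cols : Fin r → Finset (Fin h)) (hu : Function.Injective u)
    (hU : ∀ i, ((u i).card ≤ t ∧ ∀ l, u i ≠ (A l).map σ) ∨ ∃ l, u i = (C l).map σ)
    (hcols : ∀ J : Finset (Fin h), J.card ≤ t → ∃ k, cols k = J) :
    ∃ tx : Option (Fin h) → Fin h → ℂ,
      (Matrix.of fun i k : Fin r => ∏ a ∈ u i, (tx none a + ∑ q ∈ cols k, tx (some q) a)).det ≠ 0 := by
  simp only [certCheck, Bool.and_eq_true] at hc
  exact exists_table_of_packCert_map n t σ A C hA hC hAi hCi T hp hB _ _ _ hc.1 hc.2 u cols hu hU hcols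

/-- The removed sets `A` of a third-shell class coded by six naturals (binary codes of `A_0, A_1, A_2, C_0, C_1, C_2`). -/
def codedA (n : ℕ) (e : ℕ × ℕ × ℕ × ℕ × ℕ × ℕ) : Fin 3 → Finset (Fin n) :=
  ![codeSet n e.1, codeSet n e.2.1, codeSet n e.2.2.1]

/-- The added sets `C` of a coded third-shell class. -/
def codedC (n : ℕ) (e : ℕ × ℕ × ℕ × ℕ × ℕ × ℕ) : Fin 3 → Finset (Fin n) :=
  ![codeSet n e.2.2.2.1, codeSet n e.2.2.2.2.1, codeSet n e.2.2.2.2.2]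

/-- The shape hypotheses of the column (`|A_l| = t`, `|C_l| = t + 1`, both injective) as a Boolean. -/
def shapeOK (n t : ℕ) {m : ℕ} (A C : Fin m → Finset (Fin n)) : Bool :=
  decide ((∀ l, (A l).card = t) ∧ (∀ l, (C l).card = t + 1) ∧ Function.Injective A ∧ Function.Injective C)

/-- **The batch check**: every coded class of the list has the right shape and passes `certCheck` at `stdTable s n` modulo `p`. -/
def certCheckList3 (n t s p : ℕ) (l : List (ℕ × ℕ × ℕ × ℕ × ℕ × ℕ)) : Bool :=
  l.all fun e => shapeOK n t (codedA n e) (codedC n e) && certCheck n t (codedA n e) (codedC n e) (stdTable s n) p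

/-- ★★ **EVERY CLASS OF A CHECKED LIST IS SERVED FOR EVERY `h`**: if `certCheckList3 n t s p l = true` then for each coded class `e ∈ l`
the family `B_t ∖ {A_l} ∪ {C_l}` transported along any `σ : Fin n ↪ Fin h` is served (standard form). -/
theorem exists_table_of_mem_certCheckList3 (n t s : ℕ) {p : ℕ} (hp : p.Prime) (hB : 2 ^ n * (p * p) < packBase)
    (l : List (ℕ × ℕ × ℕ × ℕ × ℕ × ℕ)) (hl : certCheckList3 n t s p l = true)
    (e : ℕ × ℕ × ℕ × ℕ × ℕ × ℕ) (he : e ∈ l) {h : ℕ} (σ : Fin n ↪ Fin h)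
    {r : ℕ} (u cols : Fin r → Finset (Fin h)) (hu : Function.Injective u)
    (hU : ∀ i, ((u i).card ≤ t ∧ ∀ j, u i ≠ (codedA n e j).map σ) ∨ ∃ j, u i = (codedC n e j).map σ)
    (hcols : ∀ J : Finset (Fin h), J.card ≤ t → ∃ k, cols k = J) :
    ∃ tx : Option (Fin h) → Fin h → ℂ,
      (Matrix.of fun i k : Fin r => ∏ a ∈ u i, (tx none a + ∑ q ∈ cols k, tx (some q) a)).det ≠ 0 := by
  have hall := List.all_eq_true.mp hl e he
  rw [Bool.and_eq_true] at hall
  obtain ⟨hshape, hc⟩ := hall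
  rw [shapeOK, decide_eq_true_eq] at hshape
  obtain ⟨hA, hC, hAi, hCi⟩ := hshape
  exact exists_table_of_certCheck_map n t σ _ _ hA hC hAi hCi _ hp hB hc u cols hu hU hcols

end BallCut

end Summit.ValiantsHypothesis.ValiantsHypothesis.Theorems.BarrierLever.HiddenStates
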